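import Summits.QuantumFields.YangMills.Theorems.AlphaInputsT3ACv3LinearLiftTorus1D
import HarnessLib

/-!
# `AlphaInputsT3ACv3LinearLiftTorus1DSeg` — (LL) STEP L2a (continued): EXACT SEGMENT MEANS OF THE PERIODISED 1-FORM PROFILE ON THE CIRCLE, BOUNDS AND LOCALITY —
# cell `ym3-torus`, width seat `ym-ust-19936-w2` (g0)

Over `AlphaInputsT3ACv3LinearLiftTorus1D` (`Pσ`, `Pτ` = indicator periodisations `PS` of the dual profiles on `ℤ/(n·N_k)`):
* §4 ★ `Ptau_seg`: `Σ_{a ∈ cell c′} Σ_{m<n} Pτ(a + m, c) = n·[c = c′]` — the transported-segment mean over a block of the spread of a coarse 1-form returns the 1-form (torus form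
  of `segT_eq`, through the shift lemma `Ptau_add_nat`).
* §5 `abs_PS_le`, `abs_Psig_le` (`≤ 18`), `abs_Ptau_le` (`≤ 18/n`), `PS_eq_zero_of_far` (locality: only the three cells `q − 1, q, q + 1` are read).
HONEST FRAMING.  Elementary bookkeeping; nothing of [Balaban1987RG1]∕[Balaban1985UV3] asserted; count-neutral helper toward the (FL) row of 2′∕2′χ (`--supports
stmt-QuantumFields-19936`); registry untouched.  YM₃ on the torus is a RUNG of the programme, not the Clay problem; no claim about d = 4, infinite volume or a mass gap.

References: T. Bałaban, Commun. Math. Phys. 109 (1987) 249–301 [Balaban1987RG1] ((0.1) p.251, (0.4) p.253); Commun. Math. Phys. 102 (1985) 255–275 [Balaban1985UV3] ((38) p.266).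
-/

set_option autoImplicit false

noncomputable section

namespace Summit.QuantumFields.YangMills.Theorems.LinearLiftProfile

open Finset

variable (h : ℕ) {N₀ Nk : ℕ}

/-! ## §4 Exact segment means on the circle -/

/-- **(iv) ON THE CIRCLE — EXACT SEGMENT MEANS**: `Σ_{a ∈ cell c′} Σ_{m<n} Pτ(a + m, c) = n·[c = c′]`. [folklore] -/
theorem Ptau_seg [NeZero N₀] [NeZero Nk] (hN : N₀ = side h * Nk) (c c' : ZMod Nk) :
    ∑ a ∈ (cellFin h c' : Finset (ZMod N₀)), ∑ m ∈ range (side h), Ptau h (a + (m : ZMod N₀)) c = if c = c' then (side h : ℝ) else 0 := by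
  have e : ∀ a ∈ (cellFin h c' : Finset (ZMod N₀)), ∑ m ∈ range (side h), Ptau h (a + (m : ZMod N₀)) c =
      ∑ m ∈ range (side h), PS h (tau h) (c'.val : ℤ) (tOff h a + m) c := by
    intro a ha
    rw [mem_cellFin] at ha
    refine sum_congr rfl fun m hm => ?_
    rw [mem_range] at hm
    rw [Ptau_add_nat h hN a c m hm, ha]
  rw [sum_congr rfl e]
  unfold PS
  simp_rw [sum_comm (s := range (side h)) (t := trip)]
  rw [sum_comm]
  have e2 : ∀ r ∈ trip, ∑ a ∈ (cellFin h c' : Finset (ZMod N₀)), ∑ m ∈ range (side h), (if c = (((c'.val : ℤ) - r : ℤ) : ZMod Nk) then tau h (tOff h a + m + r * side h) else 0)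
      = if c = (((c'.val : ℤ) - r : ℤ) : ZMod Nk) then (if (-r) = 0 then (side h : ℝ) else 0) else 0 := by
    intro r _
    split_ifs with hc hr
    · rw [sum_cellFin h hN (fun t => ∑ m ∈ range (side h), tau h (t + m + r * side h))]
      have := segT_eq h (-r)
      unfold segT at this
      rw [if_pos hr] at this
      have e3 : ∑ t ∈ Icc (-(h : ℤ)) h, ∑ m ∈ range (side h), tau h (t + m + r * side h)
          = ∑ t ∈ Icc (-(h : ℤ)) h, ∑ m ∈ range (side h), tau h (t + m - (-r) * side h) :=
        sum_congr rfl fun t _ => sum_congr rfl fun m _ => by ring_nf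
      rw [e3]
      have hn0 := (side_real_pos h).ne'
      field_simp at this
      linarith
    · rw [sum_cellFin h hN (fun t => ∑ m ∈ range (side h), tau h (t + m + r * side h))]
      have := segT_eq h (-r)
      unfold segT at this
      rw [if_neg hr] at this
      have e3 : ∑ t ∈ Icc (-(h : ℤ)) h, ∑ m ∈ range (side h), tau h (t + m + r * side h)
          = ∑ t ∈ Icc (-(h : ℤ)) h, ∑ m ∈ range (side h), tau h (t + m - (-r) * side h) :=
        sum_congr rfl fun t _ => sum_congr rfl fun m _ => by ring_nf
      rw [e3]
      have hn0 := (side_real_pos h).ne'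
      rcases mul_eq_zero.mp this with h0 | h0
      · exact absurd (inv_eq_zero.mp h0) hn0
      · exact h0
    · simp
  rw [sum_congr rfl e2, sum_trip]
  have hc' : (((c'.val : ℤ) - 0 : ℤ) : ZMod Nk) = c' := by simp
  simp only [hc', neg_zero]
  by_cases hcc : c = c'
  · simp [hcc]
  · simp [hcc]

/-! ## §5 Bounds -/

/-- `|PS f| ≤ 3·(bound of f)`. [folklore] -/
theorem abs_PS_le (f : ℤ → ℝ) {C : ℝ} (hC : ∀ s, |f s| ≤ C) (q t : ℤ) (c : ZMod Nk) : |PS h f q t c| ≤ 3 * C := by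
  have hC0 : 0 ≤ C := (abs_nonneg _).trans (hC 0)
  unfold PS
  rw [sum_trip]
  have hb : ∀ r : ℤ, |(if c = ((q - r : ℤ) : ZMod Nk) then f (t + r * side h) else 0)| ≤ C := by
    intro r; split_ifs
    · exact hC _
    · simpa using hC0
  calc _ ≤ |(if c = ((q - -1 : ℤ) : ZMod Nk) then f (t + -1 * side h) else 0) + (if c = ((q - 0 : ℤ) : ZMod Nk) then f (t + 0 * side h) else 0)|
          + |(if c = ((q - 1 : ℤ) : ZMod Nk) then f (t + 1 * side h) else 0)| := abs_add_le _ _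
    _ ≤ (|(if c = ((q - -1 : ℤ) : ZMod Nk) then f (t + -1 * side h) else 0)| + |(if c = ((q - 0 : ℤ) : ZMod Nk) then f (t + 0 * side h) else 0)|)
          + |(if c = ((q - 1 : ℤ) : ZMod Nk) then f (t + 1 * side h) else 0)| := by gcongr; exact abs_add_le _ _
    _ ≤ (C + C) + C := by gcongr <;> exact hb _
    _ = 3 * C := by ring

/-- `|Pσ| ≤ 18`. [folklore] -/
theorem abs_Psig_le (a : ZMod N₀) (c : ZMod Nk) : |Psig h a c| ≤ 18 := by
  have := abs_PS_le h (sigma h) (abs_sigma_le h) (qIdx h a) (tOff h a) c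
  unfold Psig; linarith

/-- `|Pτ| ≤ 18/n`. [folklore] -/
theorem abs_Ptau_le (a : ZMod N₀) (c : ZMod Nk) : |Ptau h a c| ≤ 18 / side h := by
  have := abs_PS_le h (tau h) (abs_tau_le h) (qIdx h a) (tOff h a) c
  unfold Ptau
  calc _ ≤ 3 * (6 / (side h : ℝ)) := this
    _ = 18 / side h := by ring

/-- **LOCALITY**: `PS f q t c` vanishes unless `c` is one of the three cells `q − 1, q, q + 1` (mod `N_k`). [folklore] -/
theorem PS_eq_zero_of_far (f : ℤ → ℝ) (q t : ℤ) (c : ZMod Nk) (hc : ∀ r ∈ trip, c ≠ ((q - r : ℤ) : ZMod Nk)) : PS h f q t c = 0 := by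
  unfold PS
  exact sum_eq_zero fun r hr => if_neg (hc r hr)

end Summit.QuantumFields.YangMills.Theorems.LinearLiftProfile

end
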